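import Summits.QuantumFields.BalabanUV.Beta.GAN24.CombContactGaugeStaircaseMerged
import Summits.QuantumFields.BalabanUV.Beta.GAN24.CombContactGaugeStaircaseCauchy

/-!
# `BalabanUV.Beta.GAN24.CombContactGaugeStaircaseMergedPair` — row G-an2-4 ∕ (CONV-C), TRANSFER-III, the (III′) S-slot (b), the contact PAIRS `hPc ∕ hPcV`: **THE BORN-ALIGNED PAIR
# OF CONJUGATED GAUGE FUNCTIONS AS TWO STAIRCASES OF THE LEGS' OWN DEPTH WITH A DIFFERENCED STAIRCASE** — leaf-01 g89's `combGauge_eq_staircase` at `(m, k)` and `(m+1, k)` and the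
# born alignment `combGauge_succ_sub_eq_staircase` (pieces `abs_combGaugePiece_le` ∕ `abs_combPieceSucc_le`), every `(k+2)`-staircase folded to depth `k+1` by the OWNER's
# `CombContactGaugeStaircaseMerged` §1 — EXACTLY the six gauge letters `(hψ, hG), (hψp, hGp), (hψΔ, hGΔ)` of leaf-03's (E) pair entry bounds `ContactBorderPairEntryBound ∕
# ContactBorderEntryBoundTwo(Mf)` (and of the OWNER's sym twins (14)–(16)) at `n := k`, `αg := α₁(1+Lc)`, `αΔ := (8Lc + F(1+8Lc(e^{κ₁}+1)))·(c·θ^{m+k})·(1+Lc)·(Lc^{5(k+1)})⁻¹`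
# (OWNER `b2b-balaban-gan24-p1` gen 55; the `hPcV` leg half of `HCV-DESIGN-g55.md` §2, shared with the born-Λ pair `hPc`)

NOT IN PRINT — OUR BOOKKEEPING ([folklore] finite-sum bookkeeping over leaf-01 g89's `CombContactGaugeStaircase(Cauchy)` letters, DISPLAYED as there: leaf-12's (N1) `κ₀, C`, road-P2's
CT-4a `c, θ, κ₁`, a face letter `F ≥ faceWtSum r Lc`; `d = 3`; 0 `def`, 0 cited fact, 0 `def … : Prop`, 0 sorry; NO estimate of Bałaban's).
HONEST FRAMING (cell contract, verbatim): «discharging `BetaPertH` makes Bałaban's UV stability UNCONDITIONAL — a real constructive-QFT result; it is NOT the continuum limit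
and NOT the Clay problem.»  HONEST DEPENDENCY (verbatim): «continuum YM on T⁴ ⇐ BetaPertH ∧ nine spine estimates (0/9 proved); BetaPertH ⇐ (D1) ∧ (D4) ∧ CAP+tail; G-an2-4
gates asym, D1 and NE2/3/4.»  Discharges NO letter; NEVER «G-an2-4 closed» as (CONV-C); NOT D1, NOT BetaPertH, NOT continuum, NOT Clay.  2026-08-28; no existing file touched.

## What is proved (`d = 3`)
**`exists_combGauge_staircase_merged_pair (m k)`**: `∃ G Gp GΔ`, the merged `(k+1)`-staircases of `λ′^{(m,k)}`, of `λ′^{(m+1,k)}` and of their born-aligned difference, with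
`|G|, |Gp| ≤ (α₁(1+Lc))·Lc^s·e^{−κ₀‖quo (Lc^{k+1}) u − z‖∞}` and `|GΔ| ≤ ((8Lc + F(1+8Lc(e^{κ₁}+1)))·(c·θ^{m+k})·(Lc^{5(k+1)})⁻¹·(1+Lc))·Lc^s·e^{−κ₁‖quo (Lc^{k+1}) u − z‖∞}` (`s ≤ k`).
-/

noncomputable section

open Finset
open scoped BigOperators
open Literature.MathematicalPhysics.QuantumFieldTheory
open Literature.MathematicalPhysics.QuantumFieldTheory.LatticeForm (quo)
open Literature.MathematicalPhysics.QuantumFieldTheory.Balaban1983to89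
open Literature.MathematicalPhysics.QuantumFieldTheory.Balaban1983to89.Beta
open B4ContourShift (supNorm supNorm_nonneg)
open AffineAveraging (Site box toSite)
open AveragingContours (blk)
open KKTFluctuationKernel (delta1)
open BalabanCompositeJets (respStep)
open Summit.QuantumFields.BalabanUV.Beta.AxialProjectorBlockMean (bmGaugeAt)
open Summit.QuantumFields.BalabanUV.Beta.SymCorrectorForms (zetaS)
open Summit.QuantumFields.BalabanUV.Beta.SymCorrectorFace (faceWtSum faceWtSum_nonneg)
open Summit.QuantumFields.BalabanUV.Beta.GAN24.Push4Iter (legChain)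
open Summit.QuantumFields.BalabanUV.Beta.GAN24.RespStepBmDecompLegs (legAct)
open Summit.QuantumFields.BalabanUV.Beta.GAN24.RespStepBmDecompExact (respStepBmSeq)
open Summit.QuantumFields.BalabanUV.Beta.GAN24.RespStepBmDecompPsi (Psi)
open Summit.QuantumFields.BalabanUV.Beta.GAN24.CombLegChainGauge (PsiFace)
open Summit.QuantumFields.BalabanUV.Beta.GAN24.CombContactGaugeStaircase (combGauge_eq_staircase abs_combGaugePiece_le)
open Summit.QuantumFields.BalabanUV.Beta.GAN24.CombContactGaugeStaircaseCauchy (combGauge_succ_sub_eq_staircase abs_combPieceSucc_le)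
open Summit.QuantumFields.BalabanUV.Beta.GAN24.CombContactGaugeStaircaseMerged (sum_range_succ_eq_sum_range_mergeTop abs_mergeTop_le)

namespace Summit.QuantumFields.BalabanUV.Beta.GAN24.CombContactGaugeStaircaseMergedPair

variable {Lc : ℕ} [NeZero Lc] {κ₀ C c θ κ₁ F : ℝ} (hκ₀ : 0 ≤ κ₀) (hC : 0 ≤ C) (hκ₁ : 0 ≤ κ₁) (hc : 0 ≤ c) (hθ : 0 ≤ θ)
  (hN1 : ∀ (m k : ℕ) (μ : Fin (3 + 1)) (z : Site (3 + 1)) (l'' : Fin (3 + 1)) (w' : Site (3 + 1)),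
    |respStep (d := 3) (Lc ^ m) (Lc ^ (m + k + 1)) μ z l'' w'| ≤
      C * ((Lc : ℝ) ^ (5 * (k + 1)))⁻¹ * Real.exp (-(κ₀ * supNorm (quo (Lc ^ (k + 1)) w' - z))))
  (hCau : ∀ (s k : ℕ) (μ : Fin (3 + 1)) (z : Site (3 + 1)) (l : Fin (3 + 1)) (w : Site (3 + 1)),
    |respStep (d := 3) (Lc ^ (s + 1)) (Lc ^ (s + k + 2)) μ z l w - respStep (d := 3) (Lc ^ s) (Lc ^ (s + k + 1)) μ z l w|
      ≤ c * θ ^ (s + k) * ((((Lc ^ (k + 1) : ℕ) : ℝ)) ^ (3 + 2))⁻¹ * Real.exp (-(κ₁ * supNorm (quo (Lc ^ (k + 1)) w - z))))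
  {r : Fin (3 + 1) → ℕ} (hr : r ∈ box (3 + 1) Lc) {rr : Fin (3 + 1) → ℕ} (hrr : rr ∈ box (3 + 1) Lc) (hF : faceWtSum r Lc ≤ F)
include hκ₀ hC hκ₁ hc hθ hN1 hCau hr hrr hF

/-- NOT IN PRINT; OUR BOOKKEEPING.  **THE BORN-ALIGNED PAIR OF CONJUGATED GAUGE FUNCTIONS AS STAIRCASES OF THE LEGS' OWN DEPTH, WITH THE DIFFERENCED STAIRCASE** (`d = 3`, in-block
roots `r, rr`, `ρ = toSite rr`, every `m k`): `∃ G Gp GΔ` with `λ′^{(m,k)} = Σ_{s<k+1} G μ z s (blk (Lc^s) ·)`, `λ′^{(m+1,k)} = Σ_{s<k+1} Gp μ z s (…)`, `λ′^{(m+1,k)} − λ′^{(m,k)} = Σ_{s<k+1} GΔ μ z s (…)`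
and, for `s ≤ k`, `|G|, |Gp| ≤ (α₁(1+Lc))·Lc^s·e^{−κ₀‖quo (Lc^{k+1}) u − z‖∞}`, `|GΔ| ≤ ((8Lc + F(1+8Lc(e^{κ₁}+1)))·(c·θ^{m+k})·(Lc^{5(k+1)})⁻¹·(1+Lc))·Lc^s·e^{−κ₁‖quo (Lc^{k+1}) u − z‖∞}` —
the `(hψ,hG), (hψp,hGp), (hψΔ,hGΔ)` letters of leaf-03's pair entry bounds (and of the OWNER's sym twins) at `n := k`. -/
theorem exists_combGauge_staircase_merged_pair (m k : ℕ) :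
    ∃ G Gp GΔ : Fin (3 + 1) → Site (3 + 1) → ℕ → Site (3 + 1) → ℝ,
      (∀ (μ : Fin (3 + 1)) (z u : Site (3 + 1)),
        Psi (toSite rr) Lc m k (delta1 μ z) u + PsiFace r (toSite rr) Lc m k (delta1 μ z) u
            - bmGaugeAt (toSite rr) (respStep (d := 3) (Lc ^ m) (Lc ^ (m + k + 1)) μ z) Lc u
          = ∑ s ∈ Finset.range (k + 1), G μ z s (blk (Lc ^ s) u)) ∧
      (∀ (μ : Fin (3 + 1)) (z : Site (3 + 1)) (s : ℕ), s ≤ k → ∀ u : Site (3 + 1),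
        |G μ z s (blk (Lc ^ s) u)|
          ≤ ((8 * (Lc : ℝ) * C * ((Lc : ℝ) ^ (5 * (k + 1)))⁻¹ + F * ((1 + 8 * (Lc : ℝ) * (Real.exp κ₀ + 1)) * C * ((Lc : ℝ) ^ (5 * (k + 1)))⁻¹))
              * (1 + (Lc : ℝ))) * (Lc : ℝ) ^ s * Real.exp (-(κ₀ * supNorm (quo (Lc ^ (k + 1)) u - z)))) ∧
      (∀ (μ : Fin (3 + 1)) (z u : Site (3 + 1)),
        Psi (toSite rr) Lc (m + 1) k (delta1 μ z) u + PsiFace r (toSite rr) Lc (m + 1) k (delta1 μ z) u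
            - bmGaugeAt (toSite rr) (respStep (d := 3) (Lc ^ (m + 1)) (Lc ^ (m + 1 + k + 1)) μ z) Lc u
          = ∑ s ∈ Finset.range (k + 1), Gp μ z s (blk (Lc ^ s) u)) ∧
      (∀ (μ : Fin (3 + 1)) (z : Site (3 + 1)) (s : ℕ), s ≤ k → ∀ u : Site (3 + 1),
        |Gp μ z s (blk (Lc ^ s) u)|
          ≤ ((8 * (Lc : ℝ) * C * ((Lc : ℝ) ^ (5 * (k + 1)))⁻¹ + F * ((1 + 8 * (Lc : ℝ) * (Real.exp κ₀ + 1)) * C * ((Lc : ℝ) ^ (5 * (k + 1)))⁻¹))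
              * (1 + (Lc : ℝ))) * (Lc : ℝ) ^ s * Real.exp (-(κ₀ * supNorm (quo (Lc ^ (k + 1)) u - z)))) ∧
      (∀ (μ : Fin (3 + 1)) (z u : Site (3 + 1)),
        (Psi (toSite rr) Lc (m + 1) k (delta1 μ z) u + PsiFace r (toSite rr) Lc (m + 1) k (delta1 μ z) u
            - bmGaugeAt (toSite rr) (respStep (d := 3) (Lc ^ (m + 1)) (Lc ^ (m + 1 + k + 1)) μ z) Lc u)
          - (Psi (toSite rr) Lc m k (delta1 μ z) u + PsiFace r (toSite rr) Lc m k (delta1 μ z) u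
            - bmGaugeAt (toSite rr) (respStep (d := 3) (Lc ^ m) (Lc ^ (m + k + 1)) μ z) Lc u)
          = ∑ s ∈ Finset.range (k + 1), GΔ μ z s (blk (Lc ^ s) u)) ∧
      (∀ (μ : Fin (3 + 1)) (z : Site (3 + 1)) (s : ℕ), s ≤ k → ∀ u : Site (3 + 1),
        |GΔ μ z s (blk (Lc ^ s) u)|
          ≤ (((8 * (Lc : ℝ) + F * (1 + 8 * (Lc : ℝ) * (Real.exp κ₁ + 1))) * (c * θ ^ (m + k)) * ((Lc : ℝ) ^ (5 * (k + 1)))⁻¹) * (1 + (Lc : ℝ)))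
              * (Lc : ℝ) ^ s * Real.exp (-(κ₁ * supNorm (quo (Lc ^ (k + 1)) u - z)))) := by
  have hLc : 1 ≤ Lc := Nat.one_le_iff_ne_zero.2 (NeZero.ne Lc)
  have hF0 : 0 ≤ F := (faceWtSum_nonneg r Lc).trans hF
  -- the three `(k+2)`-staircases of leaf-01 g89, as families in `μ z`
  let G' : ℕ → Fin (3 + 1) → Site (3 + 1) → ℕ → Site (3 + 1) → ℝ := fun m μ z s y =>
    (if s ≤ k then
        (if s = 0 then -bmGaugeAt (toSite rr) (respStep (d := 3) (Lc ^ m) (Lc ^ (m + k + 1)) μ z) Lc y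
         else -(((Lc : ℝ) ^ ((3 + 1) * s))⁻¹ *
           bmGaugeAt (toSite rr) (legAct (respStep (d := 3) (Lc ^ (m + s)) (Lc ^ (m + k + 1))) (delta1 μ z)) Lc y))
      else 0)
    + (if s = 0 then 0
       else ((Lc : ℝ) ^ ((3 + 1) * (s - 1)))⁻¹ * ((((box (3 + 1) Lc).card : ℝ))⁻¹ *
         zetaS (toSite r) Lc (legAct (legChain (respStepBmSeq (d := 3) (toSite rr) Lc) (m + (s - 1)) (k - (s - 1))) (delta1 μ z)) y))
  let D' : Fin (3 + 1) → Site (3 + 1) → ℕ → Site (3 + 1) → ℝ := fun μ z s y =>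
    (if s ≤ k then
      -(((Lc : ℝ) ^ ((3 + 1) * s))⁻¹ *
        bmGaugeAt (toSite rr) (legAct (respStep (d := 3) (Lc ^ (m + 1 + s)) (Lc ^ (m + 1 + k + 1))) (delta1 μ z)
          - legAct (respStep (d := 3) (Lc ^ (m + s)) (Lc ^ (m + k + 1))) (delta1 μ z)) Lc y)
     else 0)
    + (if s = 0 then (0 : ℝ)
       else ((Lc : ℝ) ^ ((3 + 1) * (s - 1)))⁻¹ * ((((box (3 + 1) Lc).card : ℝ))⁻¹ *
         (zetaS (toSite r) Lc (legAct (legChain (respStepBmSeq (d := 3) (toSite rr) Lc) (m + 1 + (s - 1)) (k - (s - 1))) (delta1 μ z)) y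
          - zetaS (toSite r) Lc (legAct (legChain (respStepBmSeq (d := 3) (toSite rr) Lc) (m + (s - 1)) (k - (s - 1))) (delta1 μ z)) y)))
  have hpiece : ∀ (m' : ℕ) (μ : Fin (3 + 1)) (z : Site (3 + 1)) (s : ℕ), s ≤ k + 1 → ∀ u : Site (3 + 1), |G' m' μ z s (blk (Lc ^ s) u)|
      ≤ (8 * (Lc : ℝ) * C * ((Lc : ℝ) ^ (5 * (k + 1)))⁻¹ + F * ((1 + 8 * (Lc : ℝ) * (Real.exp κ₀ + 1)) * C * ((Lc : ℝ) ^ (5 * (k + 1)))⁻¹))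
          * (Lc : ℝ) ^ s * Real.exp (-(κ₀ * supNorm (quo (Lc ^ (k + 1)) u - z))) :=
    fun m' μ z s hs u => abs_combGaugePiece_le hκ₀ hC hN1 hr hrr hF m' k μ z hs u
  have hdiff : ∀ (μ : Fin (3 + 1)) (z : Site (3 + 1)) (s : ℕ), s ≤ k + 1 → ∀ u : Site (3 + 1), |D' μ z s (blk (Lc ^ s) u)|
      ≤ ((8 * (Lc : ℝ) + F * (1 + 8 * (Lc : ℝ) * (Real.exp κ₁ + 1))) * (c * θ ^ (m + k)) * ((Lc : ℝ) ^ (5 * (k + 1)))⁻¹)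
          * (Lc : ℝ) ^ s * Real.exp (-(κ₁ * supNorm (quo (Lc ^ (k + 1)) u - z))) := by
    intro μ z s hs u
    have h := abs_combPieceSucc_le hκ₁ hc hθ hCau hr hrr hF m k μ z hs u
    simpa only [mul_assoc] using h
  refine ⟨fun μ z s y => G' m μ z s y + (if s = k then G' m μ z (k + 1) (blk Lc y) else 0),
    fun μ z s y => G' (m + 1) μ z s y + (if s = k then G' (m + 1) μ z (k + 1) (blk Lc y) else 0),
    fun μ z s y => D' μ z s y + (if s = k then D' μ z (k + 1) (blk Lc y) else 0),
    fun μ z u => ?_, fun μ z s hs u => ?_, fun μ z u => ?_, fun μ z s hs u => ?_, fun μ z u => ?_, fun μ z s hs u => ?_⟩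
  · rw [combGauge_eq_staircase r (toSite rr) m k μ z u]
    exact sum_range_succ_eq_sum_range_mergeTop (G' m μ z) k u
  · exact abs_mergeTop_le hLc (by positivity) (fun u => (Real.exp_pos _).le) (hpiece m μ z) hs u
  · rw [combGauge_eq_staircase r (toSite rr) (m + 1) k μ z u]
    exact sum_range_succ_eq_sum_range_mergeTop (G' (m + 1) μ z) k u
  · exact abs_mergeTop_le hLc (by positivity) (fun u => (Real.exp_pos _).le) (hpiece (m + 1) μ z) hs u
  · rw [combGauge_succ_sub_eq_staircase r (toSite rr) m k μ z u]
    exact sum_range_succ_eq_sum_range_mergeTop (D' μ z) k u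
  · exact abs_mergeTop_le hLc (by positivity) (fun u => (Real.exp_pos _).le) (hdiff μ z) hs u

end Summit.QuantumFields.BalabanUV.Beta.GAN24.CombContactGaugeStaircaseMergedPair

end
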